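import Mathlib.Analysis.SpecialFunctions.NonIntegrable
import Literature.NumberTheory.Transcendental.KZProductIdeal
import Literature.NumberTheory.Transcendental.KZFibredRelations
import Literature.NumberTheory.Transcendental.KZRulesAssociator
import Literature.NumberTheory.Transcendental.KZCalculusProofs

/-!
# `LogKernelConjecture` (stmt-KontsevichZagierPeriods-2837) — negative knowledge for the line
`spectator-localisation` (skeleton d39c9ad6): load-bearing hypotheses of the ENGINE stubs

Drefute seat `refuter-drefute-stmt-KontsevichZagierPeriods-2837-0`, 2026-08-16. The lead's engine is
`stub_reweighting → stub_goodWeight → stub_intervalUnit → FibredSpectatorCancellation₁`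
(`[s] * c ∈ KZ.fibredRelations → c ∈ KZ.relations` for a one-dimensional spectator `s` of non-zero
value). Each theorem below is one engine statement VERBATIM with ONE hypothesis deleted, and is FALSE:

* `fibredSpectatorCancellation_false_without_value` — drop `s.value ≠ 0` from the engine's conclusion:
  the empty spectator `[∅ ⊆ ℝ¹, 0]` makes `[s] * c` a fibred relation for EVERY `c` (empty domain,
  one domain-additivity instance), while `c = [pt, 1]` is not a relation (soundness). So any proof of
  the engine must use `s.value ≠ 0` (it is used exactly once, in `stub_goodWeight`).
* `stubGoodWeight_false_without_value` — drop `s.value ≠ 0` from `stub_goodWeight`: no closed rational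
  interval sits inside the empty domain.
* `stubIntervalUnit_false_without_lt` — drop `a < b` from `stub_intervalUnit`: for `a = 1, b = 0` the
  interval representation has empty domain, `[u] * [pt,1]` is a relation and `[pt,1]` is not.
* `stubReweighting_false_without_bound` — drop the bound `|w| ≤ M` from `stub_reweighting`: the
  semialgebraic weight `w(x) = x⁻¹` (junk `0⁻¹ = 0`) admits no reweighted copy of `[[0,1], 1]`, since
  `x⁻¹` is not integrable on `[0,1]` (`intervalIntegrable_inv_iff`). Semialgebraicity of `w` alone does
  not give the additive map `φ`; boundedness (or local integrability against every representation) is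
  what makes `r'` exist.

* `stubDarkTorsion_false_without_guard` / `stubDarkTorsionWithoutValue_trivial` — the conjunct
  `stub_darkTorsion` with its guard `eval c = 0` deleted is FALSE (`c = [pt,1]`, right unit + soundness),
  and with `s.value ≠ 0` deleted is TRIVIALLY TRUE (empty spectator): both clauses are exactly the
  guards, the content is summit-strength (implied by `KZKernelConjecture` with the spectator `[[0,1],1]`).

Helpers (theorems only, no new objects): existence of `[[a,b], (b−a)⁻¹]` with exactly the domain and
integrand of the engine's `stub_intervalUnit` (`exists_intervalRep`), products with an empty-domain
factor are fibred relations, `[pt,1] ∉ relations`, `x ↦ x⁻¹` is `ℚ`-semialgebraic on `ℝ¹`. [folklore]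
-/

noncomputable section

open MeasureTheory Set MvPolynomial
open Literature.NumberTheory.Transcendental

namespace Summit.KontsevichZagierPeriods.LiouvilleUnfolding.LogKernelConjectureNegative.SpectatorEngine

variable {n k : ℕ}

/-! ## Helpers -/

/-- `[pt, 1]` is not a relation: relations evaluate to `0` (soundness), `[pt,1]` to `1`. [folklore] -/
theorem of_unit_not_mem_relations : KZ.of KZ.IntegralRep.unit ∉ KZ.relations := by
  intro h
  have h0 := KZ.relations_le_ker_eval_holds h
  rw [AddMonoidHom.mem_ker, KZ.eval_of, KZ.IntegralRep.value_unit] at h0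
  exact one_ne_zero h0

/-- A representation with empty domain is a FIBRED relation: `[r] − [r] − [r]` is a domain-additivity
instance (`∅ = ∅ ∪ ∅`), and all additivity instances are fibred generators. [folklore] -/
theorem of_mem_fibredRelations_of_domain_eq_empty (r : KZ.IntegralRep k) (h : r.domain = ∅) :
    KZ.of r ∈ KZ.fibredRelations := by
  have hgen : KZ.of r - KZ.of r - KZ.of r ∈ KZ.domainAddRel :=
    ⟨k, r, r, r, by simp [h], by simp [h], fun _ _ => rfl, fun _ _ => rfl, rfl⟩
  have h1 := KZ.fibredRelations.neg_mem (KZ.mem_fibredRelations_of_mem_domainAddRel hgen)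
  have h2 : -(KZ.of r - KZ.of r - KZ.of r) = KZ.of r := by abel
  rwa [h2] at h1

/-- The product with an empty-domain left factor has empty domain. [folklore] -/
theorem prod_domain_eq_empty_of_left (s : KZ.IntegralRep n) (hs : s.domain = ∅) (r : KZ.IntegralRep k) :
    (s.prod r).domain = ∅ := by
  ext z
  simp [KZ.IntegralRep.prod_domain, KZ.IntegralRep.mem_prodDomain, hs]

/-- **Empty spectators certify everything, fibrewise**: if `s.domain = ∅` then `[s] * c ∈
KZ.fibredRelations` for every formal combination `c`. [folklore] -/
theorem of_mul_mem_fibredRelations_of_domain_eq_empty (s : KZ.IntegralRep n) (hs : s.domain = ∅)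
    (c : KZ.FormalRep) : KZ.of s * c ∈ KZ.fibredRelations := by
  induction c using FreeAbelianGroup.induction_on with
  | zero => rw [mul_zero]; exact KZ.fibredRelations.zero_mem
  | of x =>
    obtain ⟨k, r⟩ := x
    change KZ.of s * KZ.of r ∈ KZ.fibredRelations
    rw [KZ.of_mul_of]
    exact of_mem_fibredRelations_of_domain_eq_empty _ (prod_domain_eq_empty_of_left s hs r)
  | neg x ih => rw [mul_neg]; exact KZ.fibredRelations.neg_mem ih
  | add x y hx hy => rw [mul_add]; exact KZ.fibredRelations.add_mem hx hy

/-- The closed rational coordinate interval `{a ≤ t 0 ≤ b} ⊆ ℝ¹` is `ℚ`-semialgebraic. [folklore] -/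
theorem isSemialgebraic_iccSet (a b : ℚ) :
    Literature.ModelTheory.ExponentialFields.IsSemialgebraic ℚ
      {t : Fin 1 → ℝ | (a : ℝ) ≤ t 0 ∧ t 0 ≤ (b : ℝ)} := by
  have h1 := Literature.ModelTheory.ExponentialFields.isSemialgebraic_setOf_eval_le (k := ℚ) (R := ℝ)
    (C a) (X (0 : Fin 1))
  have h2 := Literature.ModelTheory.ExponentialFields.isSemialgebraic_setOf_eval_le (k := ℚ) (R := ℝ)
    (X (0 : Fin 1)) (C b)
  simp only [aeval_X, aeval_C, eq_ratCast] at h1 h2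
  simpa [setOf_and] using h1.inter h2

/-- `{a ≤ t 0 ≤ b} ⊆ ℝ¹` is the product box `∏ [a, b]`. [folklore] -/
theorem iccSet_eq_pi (a b : ℚ) :
    {t : Fin 1 → ℝ | (a : ℝ) ≤ t 0 ∧ t 0 ≤ (b : ℝ)} = Set.pi univ (fun _ => Icc (a : ℝ) b) := by
  ext t
  simp [Pi.le_def, Fin.forall_fin_one]

/-- Lebesgue measure of `{a ≤ t 0 ≤ b} ⊆ ℝ¹`. [folklore] -/
theorem volume_iccSet (a b : ℚ) :
    volume {t : Fin 1 → ℝ | (a : ℝ) ≤ t 0 ∧ t 0 ≤ (b : ℝ)} = ENNReal.ofReal ((b : ℝ) - a) := by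
  rw [iccSet_eq_pi, volume_pi_pi]
  simp [Real.volume_Icc]

/-- **The interval representation `[[a,b], (b−a)⁻¹]` exists** with exactly the domain and
integrand prescribed by the engine's `stub_intervalUnit` (domain `{a ≤ t 0 ≤ b}`, constant integrand
`(b − a)⁻¹`; for `b < a` the domain is empty). Stated as an existence theorem so that this file
declares no new objects. [folklore] -/
theorem exists_intervalRep (a b : ℚ) :
    ∃ u : KZ.IntegralRep 1, u.domain = {t : Fin 1 → ℝ | (a : ℝ) ≤ t 0 ∧ t 0 ≤ (b : ℝ)} ∧
      u.integrand = fun _ => ((b - a : ℚ) : ℝ)⁻¹ :=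
  ⟨{ domain := {t : Fin 1 → ℝ | (a : ℝ) ≤ t 0 ∧ t 0 ≤ (b : ℝ)}
     integrand := fun _ => ((b - a : ℚ) : ℝ)⁻¹
     isSemialgebraic_domain := isSemialgebraic_iccSet a b
     isSemialgebraicFunOn_integrand := by
       refine (isSemialgebraicFunOn_aeval (isSemialgebraic_iccSet a b) (C ((b - a)⁻¹))).congr
         fun z _ => ?_
       simp only [aeval_C, eq_ratCast]
       push_cast
       rfl
     integrableOn := by
       refine integrableOn_const ?_
       rw [volume_iccSet]
       exact ENNReal.ofReal_ne_top }, rfl, rfl⟩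

/-- For `b < a` the prescribed interval domain is empty. [folklore] -/
theorem iccSet_eq_empty (a b : ℚ) (hba : b < a) :
    {t : Fin 1 → ℝ | (a : ℝ) ≤ t 0 ∧ t 0 ≤ (b : ℝ)} = ∅ := by
  ext t
  simp only [mem_setOf_eq, mem_empty_iff_false, iff_false, not_and, not_le]
  intro h
  have : (b : ℝ) < a := by exact_mod_cast hba
  linarith

/-! ## The engine's conclusion needs `s.value ≠ 0` -/

/-- **`FibredSpectatorCancellation₁` is FALSE without `s.value ≠ 0`** (the engine's conclusion with its
one hypothesis deleted): the empty spectator makes every `[s] * c` a fibred relation, and `[pt,1]` is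
not a relation. [folklore] -/
theorem fibredSpectatorCancellation_false_without_value :
    ¬ ∀ (s : KZ.IntegralRep 1) (c : KZ.FormalRep),
        KZ.of s * c ∈ KZ.fibredRelations → c ∈ KZ.relations :=
  fun h => of_unit_not_mem_relations
    (h (KZ.IntegralRep.empty 1) _
      (of_mul_mem_fibredRelations_of_domain_eq_empty _ (KZ.IntegralRep.domain_empty) _))

/-- **`stub_goodWeight` is FALSE without `s.value ≠ 0`**: for the empty spectator no closed rational
interval `[a,b]`, `a < b`, lies in the domain. (Statement: the stub verbatim, hypothesis deleted.)
[folklore] -/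
theorem stubGoodWeight_false_without_value :
    ¬ ∀ (s : KZ.IntegralRep 1), ∃ (a b : ℚ) (w : ℝ → ℝ) (M : ℝ), a < b ∧
        IsSemialgebraicFunOn ℚ (Set.univ : Set (Fin 1 → ℝ)) (fun t => w (t 0)) ∧
        (∀ x : ℝ, |w x| ≤ M) ∧
        (∀ t : Fin 1 → ℝ, (a : ℝ) ≤ t 0 → t 0 ≤ (b : ℝ) →
          t ∈ s.domain ∧ w (t 0) * s.integrand t = ((b - a : ℚ) : ℝ)⁻¹) ∧
        (∀ x : ℝ, (x < (a : ℝ) ∨ (b : ℝ) < x) → w x = 0) := by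
  intro h
  obtain ⟨a, b, w, M, hab, -, -, hin, -⟩ := h (KZ.IntegralRep.empty 1)
  have hab' : (a : ℝ) ≤ b := by exact_mod_cast hab.le
  exact (hin (fun _ => (a : ℝ)) le_rfl hab').1

/-! ## `stub_intervalUnit` needs `a < b` -/

/-- **`stub_intervalUnit` is FALSE without `a < b`**: at `a = 1`, `b = 0` the representation
`[[1,0], (0−1)⁻¹]` (`exists_intervalRep 1 0`) has the prescribed domain `{1 ≤ t 0 ≤ 0} = ∅`, so
`[u] * [pt,1]` is a relation (empty domain) while `[pt,1]` is not. [folklore] -/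
theorem stubIntervalUnit_false_without_lt :
    ¬ ∀ (a b : ℚ) (u : KZ.IntegralRep 1),
        u.domain = {t : Fin 1 → ℝ | (a : ℝ) ≤ t 0 ∧ t 0 ≤ (b : ℝ)} →
        (u.integrand = fun _ => ((b - a : ℚ) : ℝ)⁻¹) →
        ∀ c : KZ.FormalRep, KZ.of u * c - c ∈ KZ.relations := by
  intro h
  obtain ⟨u, hdom, hint⟩ := exists_intervalRep 1 0
  have h1 := h 1 0 u hdom hint (KZ.of KZ.IntegralRep.unit)
  have h2 : KZ.of u * KZ.of KZ.IntegralRep.unit ∈ KZ.relations :=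
    KZ.fibredRelations_le_relations (of_mul_mem_fibredRelations_of_domain_eq_empty _
      (hdom.trans (iccSet_eq_empty 1 0 zero_lt_one)) _)
  have h3 := KZ.relations.sub_mem h2 h1
  rw [sub_sub_cancel] at h3
  exact of_unit_not_mem_relations h3

/-! ## `stub_reweighting` needs the bound `|w| ≤ M` -/

/-- `x ↦ x⁻¹` (Mathlib's total inverse, `0⁻¹ = 0`) is `ℚ`-semialgebraic on `ℝ¹`: its graph is
`{x·y = 1} ∪ {x = 0 ∧ y = 0}`. [folklore] -/
theorem isSemialgebraicFunOn_inv_coord :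
    IsSemialgebraicFunOn ℚ (Set.univ : Set (Fin 1 → ℝ)) (fun t => (t 0)⁻¹) := by
  rw [isSemialgebraicFunOn_iff]
  have h1 := Literature.ModelTheory.ExponentialFields.isSemialgebraic_setOf_eval_eq_zero (k := ℚ)
    (R := ℝ) (X (0 : Fin 2) * X 1 - 1)
  have h2 := Literature.ModelTheory.ExponentialFields.isSemialgebraic_setOf_eval_eq_zero (k := ℚ)
    (R := ℝ) (X (0 : Fin 2))
  have h3 := Literature.ModelTheory.ExponentialFields.isSemialgebraic_setOf_eval_eq_zero (k := ℚ)
    (R := ℝ) (X (1 : Fin 2))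
  convert h1.union (h2.inter h3) using 1
  ext z
  simp only [mem_univ, true_and, mem_setOf_eq, mem_union, mem_inter_iff, map_sub, map_mul, aeval_X,
    map_one]
  have e0 : Fin.init z 0 = z 0 := rfl
  have e1 : z (Fin.last 1) = z 1 := rfl
  rw [e0, e1]
  constructor
  · intro hz
    by_cases h0 : z 0 = 0
    · right
      exact ⟨h0, by rw [hz, h0, inv_zero]⟩
    · left
      rw [hz, mul_inv_cancel₀ h0, sub_self]
  · rintro (hz | ⟨hz0, hz1⟩)
    · have hz' : z 0 * z 1 = 1 := by linarith
      exact (inv_eq_of_mul_eq_one_right hz').symm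
    · rw [hz0, hz1, inv_zero]

/-- `x ↦ x⁻¹ · C` (`C ≠ 0`) is not integrable on `[0,1] ⊆ ℝ¹` (Mathlib's
`intervalIntegrable_inv_iff`, transported along `ℝ¹ ≃ᵐ ℝ`). [folklore] -/
theorem not_integrableOn_inv_mul_const {C : ℝ} (hC : C ≠ 0) :
    ¬ IntegrableOn (fun x : Fin 1 → ℝ => (x 0)⁻¹ * C) {t : Fin 1 → ℝ | (0 : ℝ) ≤ t 0 ∧ t 0 ≤ 1} := by
  intro h
  have h1 : IntegrableOn (fun x : Fin 1 → ℝ => (x 0)⁻¹) {t : Fin 1 → ℝ | (0 : ℝ) ≤ t 0 ∧ t 0 ≤ 1} := by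
    have h' : IntegrableOn (fun x : Fin 1 → ℝ => (x 0)⁻¹ * C * C⁻¹)
        {t : Fin 1 → ℝ | (0 : ℝ) ≤ t 0 ∧ t 0 ≤ 1} := h.mul_const C⁻¹
    refine h'.congr_fun (fun x _ => ?_) ?_
    · show (x 0)⁻¹ * C * C⁻¹ = (x 0)⁻¹
      rw [mul_assoc, mul_inv_cancel₀ hC, mul_one]
    · exact (isSemialgebraic_iccSet 0 1 |> fun hs => by
        simpa using Literature.ModelTheory.ExponentialFields.IsSemialgebraic.measurableSet_holds hs)
  have hmp := MeasureTheory.volume_preserving_funUnique (Fin 1) ℝ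
  have hpre : {t : Fin 1 → ℝ | (0 : ℝ) ≤ t 0 ∧ t 0 ≤ 1} =
      MeasurableEquiv.funUnique (Fin 1) ℝ ⁻¹' Icc 0 1 := by
    ext x
    simp [MeasurableEquiv.funUnique, Fin.default_eq_zero]
  have hfun : (fun x : Fin 1 → ℝ => (x 0)⁻¹) = (fun t : ℝ => t⁻¹) ∘ MeasurableEquiv.funUnique (Fin 1) ℝ := by
    funext x
    simp [MeasurableEquiv.funUnique, Fin.default_eq_zero]
  rw [hpre, hfun] at h1
  have h2 : IntegrableOn (fun t : ℝ => t⁻¹) (Icc 0 1) :=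
    (hmp.integrableOn_comp_preimage (MeasurableEquiv.measurableEmbedding _)).mp h1
  have h3 : IntervalIntegrable (fun t : ℝ => t⁻¹) volume 0 1 :=
    (intervalIntegrable_iff_integrableOn_Icc_of_le zero_le_one).mpr h2
  rcases intervalIntegrable_inv_iff.mp h3 with h0 | h0
  · exact zero_ne_one h0
  · exact h0 (by simp)

/-- **`stub_reweighting` is FALSE without the bound `|w| ≤ M`** (the stub verbatim with that one
hypothesis — and its now idle variable `M` — deleted): for the semialgebraic weight `w(x) = x⁻¹` the
required reweighted copy `r'` of `[[0,1], 1]` would have the non-integrable integrand `x⁻¹` on `[0,1]`.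
Only the existence clause for `k = 1` is used; the additive map `φ` and the fibred clause play no
role. [folklore] -/
theorem stubReweighting_false_without_bound :
    ¬ ∀ (w : ℝ → ℝ), IsSemialgebraicFunOn ℚ (Set.univ : Set (Fin 1 → ℝ)) (fun t => w (t 0)) →
        ∃ φ : KZ.FormalRep →+ KZ.FormalRep,
          (∀ (k : ℕ) (hk : 0 < k) (r : KZ.IntegralRep k), ∃ r' : KZ.IntegralRep k,
            r'.domain = r.domain ∧ (r'.integrand = fun x => w (x ⟨0, hk⟩) * r.integrand x) ∧
            φ (KZ.of r) = KZ.of r') ∧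
          ∀ c ∈ KZ.fibredRelations, φ c ∈ KZ.fibredRelations := by
  intro h
  obtain ⟨φ, hφ, -⟩ := h (fun x => x⁻¹) isSemialgebraicFunOn_inv_coord
  obtain ⟨u, hudom, huint⟩ := exists_intervalRep 0 1
  obtain ⟨r', hdom, hint, -⟩ := hφ 1 one_pos u
  have hi := r'.integrableOn
  rw [hdom, hint, hudom, huint] at hi
  have hC : (((1 : ℚ) - 0 : ℚ) : ℝ)⁻¹ ≠ 0 := by norm_num
  refine not_integrableOn_inv_mul_const hC ?_
  have hset : {t : Fin 1 → ℝ | ((0 : ℚ) : ℝ) ≤ t 0 ∧ t 0 ≤ ((1 : ℚ) : ℝ)} =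
      {t : Fin 1 → ℝ | (0 : ℝ) ≤ t 0 ∧ t 0 ≤ 1} := by
    ext t; simp
  rw [hset] at hi
  exact hi

/-! ## The conjunct `stub_darkTorsion`: its two guards -/

/-- **`stub_darkTorsion` is FALSE without the guard `KZ.eval c = 0`** (a strengthening of the stub):
at `c = [pt,1]`, `[s] * [pt,1] − [s] ∈ relations` (right unit, `KZ.mul_of_unit_sub_mem_relations`), so
`[s] * [pt,1] ∈ relations` forces `[s] ∈ relations` and `s.value = 0` (soundness). [folklore] -/
theorem stubDarkTorsion_false_without_guard :
    ¬ ∀ c : KZ.FormalRep, ∃ s : KZ.IntegralRep 1, s.value ≠ 0 ∧ KZ.of s * c ∈ KZ.relations := by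
  intro h
  obtain ⟨s, hs, hsc⟩ := h (KZ.of KZ.IntegralRep.unit)
  have h1 := KZ.mul_of_unit_sub_mem_relations (KZ.of s)
  have h2 : KZ.of s ∈ KZ.relations := by
    have := KZ.relations.sub_mem hsc h1
    rwa [sub_sub_cancel] at this
  have h3 := KZ.relations_le_ker_eval_holds h2
  rw [AddMonoidHom.mem_ker, KZ.eval_of] at h3
  exact hs h3

/-- **`s.value ≠ 0` is the vacuity guard of `stub_darkTorsion`**: with it deleted the stub holds for
EVERY `c` (even of non-zero value), by the empty spectator. [folklore] -/
theorem stubDarkTorsionWithoutValue_trivial (c : KZ.FormalRep) :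
    ∃ s : KZ.IntegralRep 1, KZ.of s * c ∈ KZ.relations :=
  ⟨KZ.IntegralRep.empty 1, KZ.fibredRelations_le_relations
    (of_mul_mem_fibredRelations_of_domain_eq_empty _ KZ.IntegralRep.domain_empty c)⟩

/-- **`s.value ≠ 0` is NOT load-bearing for `stub_spectatorFibration` in isolation**: the empty
spectator satisfies hypothesis and conclusion for every `c` (take `c' := c`). (It is load-bearing for
the engine: `fibredSpectatorCancellation_false_without_value`.) [folklore] -/
theorem stubSpectatorFibration_holds_at_empty (c : KZ.FormalRep) :
    ∃ c' : KZ.FormalRep, c - c' ∈ KZ.relations ∧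
      KZ.of (KZ.IntegralRep.empty 1) * c' ∈ KZ.fibredRelations :=
  ⟨c, by simp [KZ.relations.zero_mem],
    of_mul_mem_fibredRelations_of_domain_eq_empty _ KZ.IntegralRep.domain_empty c⟩

end Summit.KontsevichZagierPeriods.LiouvilleUnfolding.LogKernelConjectureNegative.SpectatorEngine
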